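import Summits.AtomisticToContinuum.BoseEinsteinCondensation.Theorems.BECCutLineWeakDisorderTwoReplicaTransienceBoundFreeOneTools
import HarnessLib

/-!
# Crux `TwoReplicaTransienceBound` (stmt-AtomisticToContinuum-9687): the survival floor
# `Θ ≥ q₀ (L/2)³` of ONE free Dirichlet line on the short time window `2T ≤ L²/960`

Support file (does not close the item) for the crux
`Summit.AtomisticToContinuum.BoseEinsteinCondensation.Theses.BECCutLineWeakDisorder.TwoReplicaTransienceBound`
(route `BECCutLineWeakDisorder`, line `SketchIdeator1`, skeleton v6, lead c3): the registered stub
`stub_survivalFloor` of the short-window insertion recursion.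

The main-term coefficient of the insertion step is the flat-datum partition norm of ONE free Brownian
line killed on the boundary of the box `Λ_L = (0, L)³`,
`Θ = fkNormSq (N := 1) 0 L T 1 = ‖e^{-TΔ_D}1‖₂² = ∫_{ℝ³} Z^{(1)}_{2T}(x) dx`
(`fkNormSq_eq`: symmetry and the semigroup law, then `(ℝ³)¹ ≅ ℝ³`, `FreeGas.lintegral_config_one`).
Restricting the `x`-integral to the middle cube `(L/4, 3L/4)³` (volume `(L/2)³`,
`FreeGas.volume_middle`), where the Dirichlet survival probability up to time `2T ≤ L²/960` is at
least `q₀ = 1 - 6e⁻⁵` (`FreeGas.fkPartition_one_ge_on_middle`), gives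

* `ShortTime.fkNormSq_free_one_eq` — `Θ = ∫ Z^{(1)}_{2T}(x) dx`;
* `ShortTime.fkNormSq_free_one_ge` — **`Θ ≥ q₀ · (L/2)³`** for `0 < L`, `0 ≤ T`, `2T ≤ L²/960`;
* `TracerDecoupling.stub_survivalFloor` — the registered signature.

## References

* B. Simon, *Schrödinger semigroups*, Bull. AMS 7 (1982), §A1 (A7) (`‖e^{-tH}f‖₂² = (f, e^{-2tH}f)`).
  [Simon1982]
* D. Revuz, M. Yor, *Continuous Martingales and Brownian Motion* (1999), Ch. II Prop. (1.8) (tail of the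
  running maximum, behind `FreeGas.fkPartition_one_ge_on_middle`). [RevuzYor1999]
-/

noncomputable section

open MeasureTheory Set
open scoped ENNReal NNReal

namespace Summit.AtomisticToContinuum.BoseEinsteinCondensation.Cruxes.TwoReplicaTransienceBound.ShortTime

open Literature.MathematicalPhysics.QuantumManyBody.BoseGas

/-- **`Θ = ∫_{ℝ³} Z^{(1)}_{2T}(x) dx`**: the flat-datum partition norm `‖e^{-TΔ_D}1‖₂²` of one free
killed line is the integral over the starting point of the Dirichlet survival probability up to time
`2T` (`fkNormSq_eq` at `v ≡ 0`, `g ≡ 1`, and `(ℝ³)¹ ≅ ℝ³`). [cite: Simon1982, §A1 (A7) p. 449] -/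
theorem fkNormSq_free_one_eq (L : ℝ) {T : ℝ} (hT : 0 ≤ T) :
    fkNormSq (N := 1) (fun _ => 0) L T (fun _ => (1 : ℝ≥0∞)) =
      ∫⁻ x : Space, fkPartition (N := 1) (fun _ => 0) L (2 * T) (fun _ => x) := by
  rw [fkNormSq_eq measurable_const L hT measurable_const]
  simp only [one_mul]
  exact FreeGas.lintegral_config_one _

/-- **Survival floor `Θ ≥ q₀ · (L/2)³`** on the short window: for `0 < L`, `0 ≤ T` and
`2T ≤ L²/960`, `‖e^{-TΔ_D}1‖₂² ≥ (1 - 6e⁻⁵) (L/2)³` (restrict `∫ Z^{(1)}_{2T}` to the middle cube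
`(L/4, 3L/4)³`, of volume `(L/2)³`, on which `Z^{(1)}_{2T} ≥ q₀`). [folklore] -/
theorem fkNormSq_free_one_ge {L T : ℝ} (hL : 0 < L) (hT : 0 ≤ T) (h2T : 2 * T ≤ L ^ 2 / 960) :
    ENNReal.ofReal ((1 - 6 * Real.exp (-5)) * (L / 2) ^ 3) ≤
      fkNormSq (N := 1) (fun _ => 0) L T (fun _ => (1 : ℝ≥0∞)) := by
  rw [fkNormSq_free_one_eq L hT]
  have h2T0 : 0 ≤ 2 * T := by positivity
  calc ENNReal.ofReal ((1 - 6 * Real.exp (-5)) * (L / 2) ^ 3)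
      = ENNReal.ofReal (1 - 6 * Real.exp (-5)) *
          volume {x : Space | ∀ k, x k ∈ Set.Ioo (L / 4) (3 * L / 4)} := by
        rw [ENNReal.ofReal_mul FreeGas.q0_pos.le, ENNReal.ofReal_pow (by positivity),
          FreeGas.volume_middle]
    _ = ∫⁻ _ in {x : Space | ∀ k, x k ∈ Set.Ioo (L / 4) (3 * L / 4)},
          ENNReal.ofReal (1 - 6 * Real.exp (-5)) := (setLIntegral_const _ _).symm
    _ ≤ ∫⁻ x in {x : Space | ∀ k, x k ∈ Set.Ioo (L / 4) (3 * L / 4)},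
          fkPartition (N := 1) (fun _ => 0) L (2 * T) (fun _ => x) :=
        setLIntegral_mono (FreeGas.measurable_fkPartition_one measurable_const L (2 * T))
          fun _ hx => FreeGas.fkPartition_one_ge_on_middle measurable_const hL hx h2T0 h2T
    _ ≤ ∫⁻ x, fkPartition (N := 1) (fun _ => 0) L (2 * T) (fun _ => x) :=
        setLIntegral_le_lintegral _ _

end Summit.AtomisticToContinuum.BoseEinsteinCondensation.Cruxes.TwoReplicaTransienceBound.ShortTime

namespace Summit.AtomisticToContinuum.BoseEinsteinCondensation.Cruxes.TwoReplicaTransienceBound.TracerDecoupling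

open Literature.MathematicalPhysics.QuantumManyBody.BoseGas

/-- **Registered stub `stub_survivalFloor`** (crux stmt-AtomisticToContinuum-9687, line `SketchIdeator1`,
skeleton v6): the survival floor `Θ = ‖e^{-TΔ_D}1‖₂² ≥ q₀ (L/2)³`, `q₀ = 1 - 6e⁻⁵`, of one free
Dirichlet line in `Λ_L` on the short window `2T ≤ L²/960` (`= ShortTime.fkNormSq_free_one_ge`). -/
theorem stub_survivalFloor :
    ∀ (L T : ℝ), 0 < L → 0 ≤ T → 2 * T ≤ L ^ 2 / 960 →
      ENNReal.ofReal ((1 - 6 * Real.exp (-5)) * (L / 2) ^ 3) ≤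
        @fkNormSq 1 (fun _ => 0) L T (fun _ => (1 : ENNReal)) :=
  fun _ _ hL hT h2T => ShortTime.fkNormSq_free_one_ge hL hT h2T

end Summit.AtomisticToContinuum.BoseEinsteinCondensation.Cruxes.TwoReplicaTransienceBound.TracerDecoupling

end
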